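import Literature.Probability.LatticeModels.JordanPolyominoApproximants
import Literature.Probability.LatticeModels.KCFamilyBounds
import Literature.Probability.LatticeModels.MeshDomainBulk
import HarnessLib

/-!
# Lattice shadows of continuum paths: the bulk of a mesh domain is one component of the free sites

Topic `Literature/Probability/LatticeModels`. Geometric input of the concrete families of
Kadanoff–Ceva data along the mesh (Chelkak–Hongler–Izyurov 2015, §3.3: the analysis of the spinor
observables is run on "discrete simply connected domains `Ω_δ` approximating `Ω`"; in the tree the
free volume at mesh `δ` is the lattice component of the marked point inside
`meshInteriorFinset Ω δ`, which need not be lattice-connected). For an open connected `Ω` whose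
discretisations approximate it (`MeshApproximates Ω`) and a marked point `a ∈ Ω`:

* `mem_compOf_of_forall_box` — a site all of whose box towards a site of a component lies in the
  set belongs to that component (lattice staircases);
* `mem_compOf_nearestSite_of_path` — the nearest sites of the endpoints of a continuum path whose
  `4δ`-neighbourhood consists of sites of `T` are in the same component of `T` (the relation is
  open on `[0,1]`, `PreconnectedSpace.induction₂'`);
* **`eventually_bulk_mem_compOf`** — for a compact `K ⊆ Ω` there is `ρ > 0` such that, for all
  small `δ`, every site within `ρ` of a site with mesh point in `K` is a free site
  (`meshInteriorFinset`) in the lattice component of `nearestSite δ a` — the `bulk` clause of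
  `KCSectionFamily.IsNiceCore` for the mesh families.

Everything is proved; no named fact.

## References

* D. Chelkak, C. Hongler, K. Izyurov, Ann. of Math. 181 (2015), §2.1 and §3.3
  [ChelkakHonglerIzyurovAnnals2015].
-/

noncomputable section

namespace Literature.Probability.LatticeModels

open Filter _root_.Topology Metric Set
open Literature.Probability.LatticeModels.Polyomino

/-! ### Components and lattice staircases -/

/-- Membership in a component is symmetric. [folklore] -/
theorem mem_compOf_symm {T : Set (Site 2)} {u v : Site 2} (h : v ∈ compOf T u) : u ∈ compOf T v := by
  obtain ⟨hu, hv, hr⟩ := h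
  exact ⟨hv, hu, hr.symm⟩

/-- Membership in a component is transitive. [folklore] -/
theorem mem_compOf_trans {T : Set (Site 2)} {u v w : Site 2} (h₁ : v ∈ compOf T u) (h₂ : w ∈ compOf T v) : w ∈ compOf T u := by
  obtain ⟨hu, hv, hr⟩ := h₁
  obtain ⟨hv', hw, hr'⟩ := h₂
  exact ⟨hu, hw, hr.trans hr'⟩

/-- One coordinate step inside `T` stays in the component. [folklore] -/
theorem mem_compOf_of_single {T : Set (Site 2)} {k₀ u : Site 2} (hu : u ∈ compOf T k₀) (i : Fin 2) {s : ℤ} (hs : s = 1 ∨ s = -1)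
    (hv : u + Pi.single i s ∈ T) : u + Pi.single i s ∈ compOf T k₀ := by
  refine mem_compOf_of_adj hu hv ?_
  rw [zdGraph_adj_iff]
  rcases hs with rfl | rfl
  · exact ⟨i, Or.inl rfl⟩
  · refine ⟨i, Or.inr ?_⟩
    ext j
    by_cases hj : j = i
    · subst hj; simp
    · simp [hj]

/-- **Box staircases**: if every site of the coordinate box spanned by `u` and `v` lies in `T` and
`u` is in a component of `T`, then so is `v`. [folklore] -/
theorem mem_compOf_of_forall_box {T : Set (Site 2)} {k₀ : Site 2} :
    ∀ (n : ℕ) (u v : Site 2), (v 0 - u 0).natAbs + (v 1 - u 1).natAbs = n →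
      (∀ w : Site 2, min (u 0) (v 0) ≤ w 0 → w 0 ≤ max (u 0) (v 0) → min (u 1) (v 1) ≤ w 1 → w 1 ≤ max (u 1) (v 1) → w ∈ T) →
      u ∈ compOf T k₀ → v ∈ compOf T k₀ := by
  intro n
  induction n using Nat.strong_induction_on with
  | _ n ih =>
    intro u v hn hbox hu
    by_cases h0 : v 0 = u 0
    · by_cases h1 : v 1 = u 1
      · have : v = u := by ext i; fin_cases i <;> assumption
        rw [this]; exact hu
      · -- one step in coordinate `1`
        set s : ℤ := if u 1 < v 1 then 1 else -1 with hsdef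
        have hs : s = 1 ∨ s = -1 := by rw [hsdef]; split_ifs <;> simp
        set u' := u + Pi.single (1 : Fin 2) s with hu'
        have hu'0 : u' 0 = u 0 := by simp [hu']
        have hu'1 : u' 1 = u 1 + s := by simp [hu']
        have hu'T : u' ∈ T := by
          apply hbox <;> rw [hsdef] at hu'1 <;> split_ifs at hu'1 <;> omega
        have hu'c : u' ∈ compOf T k₀ := mem_compOf_of_single hu 1 hs hu'T
        have hlt : (v 0 - u' 0).natAbs + (v 1 - u' 1).natAbs < n := by
          rw [hsdef] at hu'1; split_ifs at hu'1 <;> omega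
        refine ih _ hlt u' v rfl (fun w h1' h2' h3' h4' => hbox w ?_ ?_ ?_ ?_) hu'c <;>
          rw [hsdef] at hu'1 <;> split_ifs at hu'1 <;> omega
    · -- one step in coordinate `0`
      set s : ℤ := if u 0 < v 0 then 1 else -1 with hsdef
      have hs : s = 1 ∨ s = -1 := by rw [hsdef]; split_ifs <;> simp
      set u' := u + Pi.single (0 : Fin 2) s with hu'
      have hu'0 : u' 0 = u 0 + s := by simp [hu']
      have hu'1 : u' 1 = u 1 := by simp [hu']
      have hu'T : u' ∈ T := by
        apply hbox <;> rw [hsdef] at hu'0 <;> split_ifs at hu'0 <;> omega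
      have hu'c : u' ∈ compOf T k₀ := mem_compOf_of_single hu 0 hs hu'T
      have hlt : (v 0 - u' 0).natAbs + (v 1 - u' 1).natAbs < n := by
        rw [hsdef] at hu'0; split_ifs at hu'0 <;> omega
      refine ih _ hlt u' v rfl (fun w h1' h2' h3' h4' => hbox w ?_ ?_ ?_ ?_) hu'c <;>
        rw [hsdef] at hu'0 <;> split_ifs at hu'0 <;> omega

/-- Coordinatewise rounding error of the nearest site: `|δ [z/δ]_i - z_i| ≤ δ/2`. [folklore] -/
theorem abs_coord_nearestSite_sub_le {δ : ℝ} (hδ : 0 < δ) (z : ℂ) :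
    |δ * (nearestSite δ z 0 : ℝ) - z.re| ≤ δ / 2 ∧ |δ * (nearestSite δ z 1 : ℝ) - z.im| ≤ δ / 2 := by
  have key : ∀ a : ℝ, |δ * (round (a / δ) : ℤ) - a| ≤ δ / 2 := fun a => by
    have h := abs_sub_round (a / δ)
    have : δ * (round (a / δ) : ℤ) - a = -(δ * (a / δ - round (a / δ))) := by
      field_simp; ring
    rw [this, abs_neg, abs_mul, abs_of_pos hδ]
    calc δ * |a / δ - round (a / δ)| ≤ δ * (1 / 2) := by gcongr
      _ = δ / 2 := by ring
  exact ⟨by simpa [nearestSite] using key z.re, by simpa [nearestSite] using key z.im⟩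

/-- The distance from a mesh point to a point is at most the sum of the coordinate errors. [folklore] -/
theorem dist_meshPoint_le_abs_add_abs (δ : ℝ) (w : Site 2) (c : ℂ) :
    dist (meshPoint δ w) c ≤ |δ * (w 0 : ℝ) - c.re| + |δ * (w 1 : ℝ) - c.im| := by
  rw [Complex.dist_eq]
  calc ‖meshPoint δ w - c‖ ≤ |(meshPoint δ w - c).re| + |(meshPoint δ w - c).im| := Complex.norm_le_abs_re_add_abs_im _
    _ = |δ * (w 0 : ℝ) - c.re| + |δ * (w 1 : ℝ) - c.im| := by simp [meshPoint_re, meshPoint_im]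

/-- A coordinate of a box site, scaled by `δ`, lies in the unordered interval of the scaled extreme
coordinates. [folklore] -/
theorem mul_mem_uIcc_of_box {δ : ℝ} (hδ : 0 ≤ δ) {p q x : ℤ} (h1 : min p q ≤ x) (h2 : x ≤ max p q) :
    δ * (x : ℝ) ∈ uIcc (δ * (p : ℝ)) (δ * (q : ℝ)) := by
  rcases le_total p q with hpq | hpq
  · rw [min_eq_left hpq] at h1; rw [max_eq_right hpq] at h2
    exact mem_uIcc.2 (Or.inl ⟨mul_le_mul_of_nonneg_left (by exact_mod_cast h1) hδ, mul_le_mul_of_nonneg_left (by exact_mod_cast h2) hδ⟩)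
  · rw [min_eq_right hpq] at h1; rw [max_eq_left hpq] at h2
    exact mem_uIcc.2 (Or.inr ⟨mul_le_mul_of_nonneg_left (by exact_mod_cast h1) hδ, mul_le_mul_of_nonneg_left (by exact_mod_cast h2) hδ⟩)

/-- **Lattice shadow of a continuum path**: if every site whose mesh point is within `4δ` of the
path `γ` lies in `T`, then the nearest sites of the endpoints of `γ` lie in the same component of
`T` (the relation is open on `[0, 1]` by a two-step staircase, hence total by connectedness). [folklore] -/
theorem mem_compOf_nearestSite_of_path {T : Set (Site 2)} {δ : ℝ} (hδ : 0 < δ) {x y : ℂ} (γ : Path x y)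
    (hγ : ∀ t, ∀ v : Site 2, dist (meshPoint δ v) (γ t) < 4 * δ → v ∈ T) :
    nearestSite δ y ∈ compOf T (nearestSite δ x) := by
  have hnear : ∀ t, nearestSite δ (γ t) ∈ T := fun t =>
    hγ t _ ((dist_meshPoint_nearestSite_le hδ (γ t)).trans_lt (by linarith))
  have key : ∀ s t : unitInterval, nearestSite δ (γ t) ∈ compOf T (nearestSite δ (γ s)) := by
    intro s₀ t₀
    refine PreconnectedSpace.induction₂' (fun s t : unitInterval => nearestSite δ (γ t) ∈ compOf T (nearestSite δ (γ s)))
      (fun s => ?_) ⟨fun a b c hab hbc => mem_compOf_trans hab hbc⟩ s₀ t₀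
    have hcont : ContinuousAt γ s := γ.continuous.continuousAt
    filter_upwards [hcont (Metric.ball_mem_nhds (γ s) (by positivity : (0 : ℝ) < δ / 4))] with t ht
    have hts : dist (γ t) (γ s) < δ / 4 := Metric.mem_ball.1 ht
    -- the two nearest sites differ by at most one in each coordinate
    set u := nearestSite δ (γ s) with hu
    set v := nearestSite δ (γ t) with hv
    obtain ⟨hu0, hu1⟩ := abs_coord_nearestSite_sub_le hδ (γ s)
    obtain ⟨hv0, hv1⟩ := abs_coord_nearestSite_sub_le hδ (γ t)
    rw [← hu] at hu0 hu1; rw [← hv] at hv0 hv1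
    have hre : |(γ t).re - (γ s).re| < δ / 4 :=
      (Complex.abs_re_le_norm (γ t - γ s)).trans_lt (by rwa [← Complex.dist_eq])
    have him : |(γ t).im - (γ s).im| < δ / 4 :=
      (Complex.abs_im_le_norm (γ t - γ s)).trans_lt (by rwa [← Complex.dist_eq])
    have hd0 : |(v 0 : ℝ) - u 0| < 2 := by
      have h1 : |δ * (v 0 : ℝ) - δ * u 0| < 2 * δ :=
        calc |δ * (v 0 : ℝ) - δ * u 0| ≤ |δ * (v 0 : ℝ) - (γ t).re| + |(γ t).re - δ * u 0| := abs_sub_le _ _ _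
          _ ≤ |δ * (v 0 : ℝ) - (γ t).re| + (|(γ t).re - (γ s).re| + |(γ s).re - δ * u 0|) :=
              add_le_add le_rfl (abs_sub_le _ _ _)
          _ < δ / 2 + (δ / 4 + δ / 2) := by rw [abs_sub_comm ((γ s).re)]; linarith
          _ < 2 * δ := by linarith
      rw [← mul_sub, abs_mul, abs_of_pos hδ] at h1
      by_contra hc; push Not at hc; nlinarith
    have hd1 : |(v 1 : ℝ) - u 1| < 2 := by
      have h1 : |δ * (v 1 : ℝ) - δ * u 1| < 2 * δ :=
        calc |δ * (v 1 : ℝ) - δ * u 1| ≤ |δ * (v 1 : ℝ) - (γ t).im| + |(γ t).im - δ * u 1| := abs_sub_le _ _ _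
          _ ≤ |δ * (v 1 : ℝ) - (γ t).im| + (|(γ t).im - (γ s).im| + |(γ s).im - δ * u 1|) :=
              add_le_add le_rfl (abs_sub_le _ _ _)
          _ < δ / 2 + (δ / 4 + δ / 2) := by rw [abs_sub_comm ((γ s).im)]; linarith
          _ < 2 * δ := by linarith
      rw [← mul_sub, abs_mul, abs_of_pos hδ] at h1
      by_contra hc; push Not at hc; nlinarith
    have hz0 : -1 ≤ v 0 - u 0 ∧ v 0 - u 0 ≤ 1 := by
      have : |((v 0 - u 0 : ℤ) : ℝ)| < 2 := by push_cast; exact hd0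
      have h2 : |v 0 - u 0| < 2 := by exact_mod_cast this
      have := abs_lt.1 h2; omega
    have hz1 : -1 ≤ v 1 - u 1 ∧ v 1 - u 1 ≤ 1 := by
      have : |((v 1 - u 1 : ℤ) : ℝ)| < 2 := by push_cast; exact hd1
      have h2 : |v 1 - u 1| < 2 := by exact_mod_cast this
      have := abs_lt.1 h2; omega
    -- every site of the box spanned by `u` and `v` is within `4δ` of `γ s`
    have hT : ∀ w : Site 2, min (u 0) (v 0) ≤ w 0 → w 0 ≤ max (u 0) (v 0) → min (u 1) (v 1) ≤ w 1 → w 1 ≤ max (u 1) (v 1) → w ∈ T := by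
      intro w h1 h2 h3 h4
      refine hγ s w ?_
      have hw0' : |(w 0 : ℝ) - u 0| ≤ 1 := by
        have : -1 ≤ w 0 - u 0 ∧ w 0 - u 0 ≤ 1 := by omega
        rw [abs_le]; exact_mod_cast this
      have hw1' : |(w 1 : ℝ) - u 1| ≤ 1 := by
        have : -1 ≤ w 1 - u 1 ∧ w 1 - u 1 ≤ 1 := by omega
        rw [abs_le]; exact_mod_cast this
      have hw0 : |δ * (w 0 : ℝ) - (γ s).re| ≤ δ + δ / 2 :=
        calc |δ * (w 0 : ℝ) - (γ s).re| ≤ |δ * (w 0 : ℝ) - δ * u 0| + |δ * (u 0 : ℝ) - (γ s).re| := abs_sub_le _ _ _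
          _ ≤ δ * 1 + δ / 2 := add_le_add (by rw [← mul_sub, abs_mul, abs_of_pos hδ]; gcongr) hu0
          _ = δ + δ / 2 := by ring
      have hw1 : |δ * (w 1 : ℝ) - (γ s).im| ≤ δ + δ / 2 :=
        calc |δ * (w 1 : ℝ) - (γ s).im| ≤ |δ * (w 1 : ℝ) - δ * u 1| + |δ * (u 1 : ℝ) - (γ s).im| := abs_sub_le _ _ _
          _ ≤ δ * 1 + δ / 2 := add_le_add (by rw [← mul_sub, abs_mul, abs_of_pos hδ]; gcongr) hu1
          _ = δ + δ / 2 := by ring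
      calc dist (meshPoint δ w) (γ s) ≤ |δ * (w 0 : ℝ) - (γ s).re| + |δ * (w 1 : ℝ) - (γ s).im| := dist_meshPoint_le_abs_add_abs _ _ _
        _ ≤ (δ + δ / 2) + (δ + δ / 2) := add_le_add hw0 hw1
        _ < 4 * δ := by linarith
    have hvu : v ∈ compOf T u := mem_compOf_of_forall_box _ u v rfl hT (mem_compOf_self (hnear s))
    exact ⟨hvu, mem_compOf_symm hvu⟩
  simpa only [γ.source, γ.target] using key 0 1

/-! ### The bulk clause for mesh families -/

/-- Sites whose mesh points lie in the mesh polygon of the free sites are free. [cite: ChelkakHonglerIzyurovAnnals2015, §2.1] -/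
theorem mem_meshInteriorFinset_of_meshPoint_mem {Ω : Set ℂ} {δ : ℝ} (hδ : 0 < δ) {y : Site 2}
    (hy : meshPoint δ y ∈ meshInteriorPolygon Ω δ) : y ∈ meshInteriorFinset Ω δ :=
  mem_of_mem_meshPolygon hδ hy (meshPoint_mem_meshCell hδ.le y)

/-- **The bulk of a mesh domain is one component of the free sites.** For an open connected `Ω`
whose discretisations approximate it, a marked point `a ∈ Ω` and a compact `K ⊆ Ω` there is
`ρ > 0` such that, for all small `δ`, every site within Euclidean distance `ρ` of a site with mesh
point in `K` is a free site of `Ω_δ` in the lattice component of `nearestSite δ a` inside the free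
sites. [cite: ChelkakHonglerIzyurovAnnals2015, §2.1 (Ω_δ approximates Ω) and §3.3] -/
theorem eventually_bulk_mem_compOf {Ω : Set ℂ} (hΩo : IsOpen Ω) (hΩc : IsConnected Ω) (hM : MeshApproximates Ω)
    {a : ℂ} (ha : a ∈ Ω) {K : Set ℂ} (hK : IsCompact K) (hKΩ : K ⊆ Ω) :
    ∃ ρ > 0, ∀ᶠ δ in 𝓝[>] (0 : ℝ), ∀ x y : Site 2, meshPoint δ x ∈ K → dist (meshPoint δ y) (meshPoint δ x) ≤ ρ →
      y ∈ meshInteriorFinset Ω δ ∧ y ∈ compOf (↑(meshInteriorFinset Ω δ) : Set (Site 2)) (nearestSite δ a) := by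
  classical
  -- a margin `r₀ = 4r` around `K` inside `Ω`
  obtain ⟨r₀, hr₀, hr₀Ω⟩ := hK.exists_cthickening_subset_open hΩo hKΩ
  set r := r₀ / 4 with hrdef
  have hr : 0 < r := by positivity
  -- finite cover of `K` by balls of radius `r` centred in `K`
  obtain ⟨t, htK, hcov⟩ := hK.elim_nhds_subcover (fun z => ball z r) (fun z _ => ball_mem_nhds z hr)
  -- paths from `a` to the centres, with margins inside `Ω`
  have hpc : IsPathConnected Ω := (hΩo.isConnected_iff_isPathConnected).1 hΩc
  have hpath : ∀ z : t, ∃ (γ : Path a (z : ℂ)) (d : ℝ), 0 < d ∧ cthickening d (range γ) ⊆ Ω := by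
    rintro ⟨z, hz⟩
    have hj : JoinedIn Ω a z := hpc.joinedIn a ha z (hKΩ (htK z hz))
    have hsub : range hj.somePath ⊆ Ω := range_subset_iff.2 hj.somePath_mem
    obtain ⟨d, hd, hdΩ⟩ := (isCompact_range hj.somePath.continuous).exists_cthickening_subset_open hΩo hsub
    exact ⟨hj.somePath, d, hd, hdΩ⟩
  choose γ d hd hdΩ using hpath
  -- the big compact inside `Ω`
  set Kbig : Set ℂ := cthickening r₀ K ∪ ⋃ z : t, cthickening (d z / 2) (range (γ z)) with hKbig
  have hKbigc : IsCompact Kbig := by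
    refine hK.cthickening.union (isCompact_iUnion fun z => (isCompact_range (γ z).continuous).cthickening)
  have hKbigΩ : Kbig ⊆ Ω := by
    refine union_subset hr₀Ω (iUnion_subset fun z => (cthickening_mono (by linarith [hd z]) _).trans (hdΩ z))
  have hpoly := hM.2.2 Kbig hKbigc hKbigΩ
  have hdsmall : ∀ᶠ δ in 𝓝[>] (0 : ℝ), ∀ z : t, 4 * δ ≤ d z / 2 := by
    refine eventually_all.2 fun z => ?_
    have : ∀ᶠ δ in 𝓝[>] (0 : ℝ), δ ≤ d z / 8 := nhdsWithin_le_nhds (Iic_mem_nhds (by linarith [hd z]))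
    exact this.mono fun δ hδ => by linarith
  have hrsmall : ∀ᶠ δ in 𝓝[>] (0 : ℝ), δ ≤ r := nhdsWithin_le_nhds (Iic_mem_nhds hr)
  refine ⟨r, hr, ?_⟩
  filter_upwards [hpoly, hdsmall, hrsmall, self_mem_nhdsWithin] with δ hpol hdδ hrδ hδ0 x y hx hy
  have hδ : (0 : ℝ) < δ := hδ0
  set T : Set (Site 2) := ↑(meshInteriorFinset Ω δ) with hT
  have hfree : ∀ w : Site 2, meshPoint δ w ∈ Kbig → w ∈ T := fun w hw =>
    Finset.mem_coe.2 (mem_meshInteriorFinset_of_meshPoint_mem hδ (hpol hw))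
  -- the centre `z ∈ t` near `x`
  obtain ⟨z, hz, hxz⟩ := mem_iUnion₂.1 (hcov hx)
  have hxz' : dist (meshPoint δ x) z < r := mem_ball.1 hxz
  have hyz : dist (meshPoint δ y) z < 2 * r := by
    calc dist (meshPoint δ y) z ≤ dist (meshPoint δ y) (meshPoint δ x) + dist (meshPoint δ x) z := dist_triangle _ _ _
      _ < r + r := add_lt_add_of_le_of_lt hy hxz'
      _ = 2 * r := by ring
  have hzK : z ∈ K := htK z hz
  -- everything within `4r = r₀` of `z` is in `Kbig`
  have hnearz : ∀ w : Site 2, dist (meshPoint δ w) z ≤ r₀ → w ∈ T := fun w hw =>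
    hfree w (Or.inl (Metric.mem_cthickening_of_dist_le _ z _ _ hzK hw))
  constructor
  · exact hnearz y (by linarith)
  · -- `nearestSite δ z` is in the component of `nearestSite δ a` (shadow of the path `γ z`)
    have hshadow : nearestSite δ z ∈ compOf T (nearestSite δ a) := by
      refine mem_compOf_nearestSite_of_path hδ (γ ⟨z, hz⟩) fun s v hv => hfree v (Or.inr ?_)
      refine mem_iUnion.2 ⟨⟨z, hz⟩, Metric.mem_cthickening_of_dist_le _ ((γ ⟨z, hz⟩) s) _ _ (mem_range_self s) ?_⟩
      exact hv.le.trans (hdδ ⟨z, hz⟩)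
    -- `y` is reached from `nearestSite δ z` through the box, which stays within `r₀` of `z`
    refine mem_compOf_trans hshadow (mem_compOf_of_forall_box _ (nearestSite δ z) y rfl (fun w h1 h2 h3 h4 => hnearz w ?_)
      (mem_compOf_self ?_))
    · obtain ⟨hu0, hu1⟩ := abs_coord_nearestSite_sub_le hδ z
      have hy0 : |δ * (y 0 : ℝ) - z.re| ≤ 2 * r :=
        ((Complex.abs_re_le_norm (meshPoint δ y - z)).trans (by rw [← Complex.dist_eq]; exact hyz.le)).trans_eq' (by simp [meshPoint_re])
      have hy1 : |δ * (y 1 : ℝ) - z.im| ≤ 2 * r :=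
        ((Complex.abs_im_le_norm (meshPoint δ y - z)).trans (by rw [← Complex.dist_eq]; exact hyz.le)).trans_eq' (by simp [meshPoint_im])
      have hw0 : |δ * (w 0 : ℝ) - z.re| ≤ 2 * r :=
        (abs_sub_le_max_of_mem_uIcc (mul_mem_uIcc_of_box hδ.le h1 h2)).trans (max_le (hu0.trans (by linarith)) hy0)
      have hw1 : |δ * (w 1 : ℝ) - z.im| ≤ 2 * r :=
        (abs_sub_le_max_of_mem_uIcc (mul_mem_uIcc_of_box hδ.le h3 h4)).trans (max_le (hu1.trans (by linarith)) hy1)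
      calc dist (meshPoint δ w) z ≤ |δ * (w 0 : ℝ) - z.re| + |δ * (w 1 : ℝ) - z.im| := dist_meshPoint_le_abs_add_abs _ _ _
        _ ≤ 2 * r + 2 * r := add_le_add hw0 hw1
        _ = r₀ := by rw [hrdef]; ring
    · exact hnearz _ ((dist_meshPoint_nearestSite_le hδ z).trans (by linarith))

end Literature.Probability.LatticeModels
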